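import Summits.RiemannHypothesis.RiemannHypothesis.Theorems.GroundBartaEvenWinsBeyondArchDeflationUpperY
import Summits.RiemannHypothesis.RiemannHypothesis.Theorems.GroundBartaEvenWinsBeyondArchArchM78YW78e1
import HarnessLib

/-!
# The parity ladder beyond `log 2`: U-side at `b = 39/50` — `ε(39/50) ≤ 1/(70·10¹²)`

Support file (GroundBarta rung 4 / WeilParity item stmt-RiemannHypothesis-18085, helper), RH-free.  Prover A (gen 2).
Rayleigh–Ritz upper bound at the window `39/50` from the A-layer certificates of the even degree-`26` trial vector `w78e1`
(`w78e1_T`), the exact norm and the Markov bracket `m78_markov_mem`: `ε(39/50) ≤ 1.415078e-14 ≤ 1/(70·10¹²)`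
(`dt_groundEnergy_le_of_T`).  U-side of the cell `[39/50, ·]`.
-/

set_option linter.dupNamespace false

noncomputable section

namespace Summit.RiemannHypothesis.RiemannHypothesis.Theorems.EvenWinsBeyondArch

open Literature.NumberTheory.LFunctions Literature.Analysis.ValidatedNumerics.ExpPoly
open Literature.Analysis.ValidatedNumerics.PolyMP Summit.RiemannHypothesis.RiemannHypothesis.Theorems.EvenWinsBeyondArch.ArchM78Y

set_option maxHeartbeats 0 in
/-- The exact `∫_{-1}^{1} P²` of the U-side trial vector at `39/50`. [folklore] -/
theorem w78e1_IQ : integPolyQ w78e1P w78e1P 1 = ((4585941378642229064943804843692130408448820471849791538231587919 : ℚ)/3577034275340938670657722998027086286216219697294778986974412800) := by decide +kernel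

/-- **`ε(39/50) ≤ 1/(70·10¹²)`** (U-side at `39/50`). [folklore] -/
theorem trialUpper78 : weilGroundEnergy (39 / 50 : ℝ) ≤ (1 / 70000000000000 : ℝ) := by
  have hT := w78e1_T
  have hM := m78_markov_mem
  have h := dt_groundEnergy_le_of_T w78e1P w78e1E (b := 39 / 50) (by norm_num) w78e1_hE
    (Thi := 317735303000630716132505779543739524293197034738465845473857727542301946796142507101377823531705270511569387716238237232615520329679138809862999/38216178155351908874548322628494511604874142065115160117248000000000000000000000000000000000000000000000000000000000000000000000000000000000000) (Mlo := 8314156944449285937 / 1000000000000000000)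
    (by push_cast at hT ⊢; exact hT.2) (by push_cast at hM ⊢; exact hM.1) (by rw [w78e1_IQ]; norm_num)
  rw [w78e1_IQ] at h
  push_cast at h
  refine le_trans h ?_
  norm_num

end Summit.RiemannHypothesis.RiemannHypothesis.Theorems.EvenWinsBeyondArch

end
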